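import Summits.NavierStokesRegularity.NavierStokesRegularity.Theses.EfficiencyFloor
import HarnessLib

/-!
# Route `EfficiencyFloor`, crux `MaximiserSetRigidity` (stmt-NavierStokesRegularity-25512), part (b):
# TYPED REDUCTION — (b) for a normalised maximiser follows from the ENSTROPHY BALANCE of relative-equilibrium profiles and a
# Liouville theorem for COLLAPSING (`c′ > 0`) profiles only

Sequel to `…MaximiserSetRigidityEnstrophyBalance` (p820129: the algebraic half; its one needed consequence is re-derived here as
`rate_pos_of_balance`, so that this file imports only the route file). `--supports stmt-NavierStokesRegularity-25512 --as helper`.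
Pure logic: the two analytic inputs are taken as hypotheses, spelled out in the item's own
vocabulary (`ν`, admissibility, the skew `W`, the profile equation VERBATIM from the route decl):

* (EB) `enstrophy balance`: every admissible `m` solving
  `νΔm − (m·∇)m − ∇π = (a·∇)m + ((Wx)·∇)m − Wm + c′(m + (x·∇)m)` (`π` smooth, `W` skew) has `S(m) − ν·Pal(m) = (c′/2)·Z(m)`
  — provable mathematics (curl of the equation tested against `ω = curl m` with the tree's whole-space cut-off integration by
  parts; pressure-free), NOT proved here;
* (L⁺) `collapse Liouville`: no admissible `m` with `Z(m) > 0` solves that equation with `c′ > 0` — the backward self-similar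
  (rotating, translating) Liouville theorem of Nečas–Růžička–Šverák / Tsai / Pineau–Vicol type in the class `D⁰m, D¹m, D²m ∈ L²`
  (tree named facts `pineauVicol2026_rss_liouville` & co., hypotheses to be matched), NOT proved here.

* `partB_of_enstrophyBalance_of_collapseLiouville` — for `c, ν > 0`: (EB) → (L⁺) → for every `m` satisfying the item's
  normalised-maximiser clause verbatim, the item's (b)-clause verbatim (`∀ π a W c', … → ¬ profile equation`). Case `c′ ≤ 0`:
  (EB) and `EnstrophyBalance.of_normalisedMaximiser` give `c′ = (27c⁴/(128ν³))Z(m)² > 0`, contradiction; case `c′ > 0`: (L⁺).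

READING. Part (b) of stmt-25512 = (EB) [L, elementary] + (L⁺) [Liouville for collapsing profiles, in print]; part (a) (finitely
many maximiser orbits) is untouched and remains the bet. HONEST FRAMING: an implication with two unproved analytic hypotheses;
stmt-25512, `RigidExit`, `LerayFloorGap`, `ProductionEfficiencyDecay` and Navier–Stokes regularity stay OPEN; no summit
statement is proved. [folklore]
-/

-- the problem directory repeats the summit name (`NavierStokesRegularity/NavierStokesRegularity`)
set_option linter.dupNamespace false

noncomputable section

namespace Summit.NavierStokesRegularity.NavierStokesRegularity.Theorems

namespace MaximiserSetRigidity

open MeasureTheory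
open scoped InnerProductSpace
open Literature.Analysis.FluidPDE

/-- **The enstrophy balance of a normalised maximiser forces a positive self-similar rate** (re-derivation of
`EnstrophyBalance.rate_eq_of_enstrophyBalance` / `not_rate_nonpos_of_enstrophyBalance`, p820129, kept local so that this
file does not import a Theorems module): for `c, ν, Z > 0`, `Pal ≥ 0`, `S = cZ^{3/4}Pal^{3/4}`, `Pal = (81c⁴/(256ν⁴))Z³` and
`S − ν·Pal = (c′/2)·Z`, one has `0 < c′` (indeed `c′ = (27c⁴/(128ν³))Z²`). [folklore] -/
theorem rate_pos_of_balance {c ν Z P S c' : ℝ} (hc : 0 < c) (hν : 0 < ν) (hZ : 0 < Z) (hP : 0 ≤ P)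
    (hS : S = c * Z ^ (3 / 4 : ℝ) * P ^ (3 / 4 : ℝ)) (hN : P = 81 * c ^ 4 / (256 * ν ^ 4) * Z ^ 3)
    (hEB : S - ν * P = c' / 2 * Z) : 0 < c' := by
  set b : ℝ := P ^ (1 / 4 : ℝ) with hb_def
  set a : ℝ := Z ^ (3 / 4 : ℝ) with ha_def
  have hb : 0 ≤ b := Real.rpow_nonneg hP _
  have ha : 0 < a := Real.rpow_pos_of_pos hZ _
  have hP1 : P = b ^ 4 := by
    rw [hb_def, ← Real.rpow_mul_natCast hP]; norm_num
  have hP34 : P ^ (3 / 4 : ℝ) = b ^ 3 := by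
    rw [hb_def, ← Real.rpow_mul_natCast hP]; norm_num
  have hZ3 : Z ^ 3 = a ^ 4 := by
    rw [ha_def, ← Real.rpow_mul_natCast hZ.le]; norm_num
  set Y : ℝ := 3 * c / (4 * ν) with hY_def
  have hY : 0 < Y := by positivity
  have hb4 : b ^ 4 = (Y * a) ^ 4 := by
    rw [← hP1, hN, hZ3, hY_def]; field_simp; ring
  have hbYa : b = Y * a := (pow_left_inj₀ hb (mul_nonneg hY.le ha.le) (by norm_num : (4 : ℕ) ≠ 0)).1 hb4
  -- `S − νP = a⁴ Y³ (c − ν Y) = a⁴ Y³ c / 4 > 0`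
  have hpos : 0 < S - ν * P := by
    rw [hS, hP34, hP1, hbYa]
    have e : c * a * (Y * a) ^ 3 - ν * (Y * a) ^ 4 = a ^ 4 * Y ^ 3 * (c - ν * Y) := by ring
    rw [e]
    have hcY : 0 < c - ν * Y := by
      rw [hY_def]
      have : c - ν * (3 * c / (4 * ν)) = c / 4 := by field_simp; ring
      rw [this]; positivity
    positivity
  rw [hEB] at hpos
  by_contra h
  have hc'0 : c' ≤ 0 := not_lt.1 h
  have : c' / 2 * Z ≤ 0 := mul_nonpos_of_nonpos_of_nonneg (by linarith) hZ.le
  linarith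

/-- **Part (b) of `MaximiserSetRigidity` for a normalised maximiser, from (EB) and (L⁺).** See the module docstring for
the two hypotheses; the conclusion is the item's (b)-clause verbatim for the given `m`. [folklore] -/
theorem partB_of_enstrophyBalance_of_collapseLiouville (c ν : ℝ) (hc : 0 < c) (hν : 0 < ν)
    (hEB : ∀ (m : EuclideanSpace ℝ (Fin 3) → EuclideanSpace ℝ (Fin 3)) (π : EuclideanSpace ℝ (Fin 3) → ℝ) (a :
      EuclideanSpace ℝ (Fin 3)) (W : EuclideanSpace ℝ (Fin 3) →L[ℝ] EuclideanSpace ℝ (Fin 3)) (c' : ℝ),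
      (ContDiff ℝ (⊤ : ℕ∞) m ∧ Literature.Analysis.FluidPDE.VectorCalculus.IsDivFree m ∧ (∫⁻ x,
      ‖iteratedFDeriv ℝ 0 m x‖ₑ ^ 2 < ⊤) ∧ (∫⁻ x, ‖iteratedFDeriv ℝ 1 m x‖ₑ ^ 2 < ⊤) ∧ (∫⁻ x, ‖iteratedFDeriv
      ℝ 2 m x‖ₑ ^ 2 < ⊤)) → ContDiff ℝ (⊤ : ℕ∞) π → (∀ x y : EuclideanSpace ℝ (Fin 3), ⟪W x, y⟫_ℝ = -⟪x, W
      y⟫_ℝ) → (∀ x : EuclideanSpace ℝ (Fin 3), ν • Laplacian.laplacian m x -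
      Literature.Analysis.FluidPDE.convect m m x - gradient π x = fderiv ℝ m x a + (fderiv ℝ m x (W x) - W (m
      x)) + c' • (m x + fderiv ℝ m x x)) → (∫ x, ⟪Literature.Analysis.FluidPDE.curl m x, fderiv ℝ m x
      (Literature.Analysis.FluidPDE.curl m x)⟫_ℝ) - ν * (∫ x, Literature.Analysis.FluidPDE.frobeniusNormSq
      (fderiv ℝ (Literature.Analysis.FluidPDE.curl m) x)) = c' / 2 * (∫ x, ‖Literature.Analysis.FluidPDE.curl
      m x‖ ^ 2))
    (hL : ∀ (m : EuclideanSpace ℝ (Fin 3) → EuclideanSpace ℝ (Fin 3)) (π : EuclideanSpace ℝ (Fin 3) → ℝ) (a :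
      EuclideanSpace ℝ (Fin 3)) (W : EuclideanSpace ℝ (Fin 3) →L[ℝ] EuclideanSpace ℝ (Fin 3)) (c' : ℝ),
      (ContDiff ℝ (⊤ : ℕ∞) m ∧ Literature.Analysis.FluidPDE.VectorCalculus.IsDivFree m ∧ (∫⁻ x,
      ‖iteratedFDeriv ℝ 0 m x‖ₑ ^ 2 < ⊤) ∧ (∫⁻ x, ‖iteratedFDeriv ℝ 1 m x‖ₑ ^ 2 < ⊤) ∧ (∫⁻ x, ‖iteratedFDeriv
      ℝ 2 m x‖ₑ ^ 2 < ⊤)) → 0 < (∫ x, ‖Literature.Analysis.FluidPDE.curl m x‖ ^ 2) → ContDiff ℝ (⊤ : ℕ∞) π →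
      (∀ x y : EuclideanSpace ℝ (Fin 3), ⟪W x, y⟫_ℝ = -⟪x, W y⟫_ℝ) → 0 < c' → ¬ (∀ x : EuclideanSpace ℝ (Fin
      3), ν • Laplacian.laplacian m x - Literature.Analysis.FluidPDE.convect m m x - gradient π x = fderiv ℝ m
      x a + (fderiv ℝ m x (W x) - W (m x)) + c' • (m x + fderiv ℝ m x x)))
    (m : EuclideanSpace ℝ (Fin 3) → EuclideanSpace ℝ (Fin 3))
    (hm : ((ContDiff ℝ (⊤ : ℕ∞) m ∧ Literature.Analysis.FluidPDE.VectorCalculus.IsDivFree m ∧ (∫⁻ x, ‖iteratedFDeriv ℝ 0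
      m x‖ₑ ^ 2 < ⊤) ∧ (∫⁻ x, ‖iteratedFDeriv ℝ 1 m x‖ₑ ^ 2 < ⊤) ∧ (∫⁻ x, ‖iteratedFDeriv ℝ 2 m x‖ₑ ^ 2 < ⊤))
      ∧ 0 < (∫ x, ‖Literature.Analysis.FluidPDE.curl m x‖ ^ 2) ∧ (∫ x, ⟪Literature.Analysis.FluidPDE.curl m x,
      fderiv ℝ m x (Literature.Analysis.FluidPDE.curl m x)⟫_ℝ) = c * (∫ x, ‖Literature.Analysis.FluidPDE.curl
      m x‖ ^ 2) ^ (3 / 4 : ℝ) * (∫ x, Literature.Analysis.FluidPDE.frobeniusNormSq (fderiv ℝ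
      (Literature.Analysis.FluidPDE.curl m) x)) ^ (3 / 4 : ℝ) ∧ (∫ x,
      Literature.Analysis.FluidPDE.frobeniusNormSq (fderiv ℝ (Literature.Analysis.FluidPDE.curl m) x)) = 81 *
      c ^ 4 / (256 * ν ^ 4) * (∫ x, ‖Literature.Analysis.FluidPDE.curl m x‖ ^ 2) ^ 3)) :
    ∀ (π : EuclideanSpace ℝ (Fin 3) → ℝ) (a : EuclideanSpace ℝ (Fin 3)) (W : EuclideanSpace ℝ (Fin 3) →L[ℝ]
    EuclideanSpace ℝ (Fin 3)) (c' : ℝ), ContDiff ℝ (⊤ : ℕ∞) π → (∀ x y : EuclideanSpace ℝ (Fin 3), ⟪W x, y⟫_ℝ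
    = -⟪x, W y⟫_ℝ) → ¬ (∀ x : EuclideanSpace ℝ (Fin 3), ν • Laplacian.laplacian m x -
    Literature.Analysis.FluidPDE.convect m m x - gradient π x = fderiv ℝ m x a + (fderiv ℝ m x (W x) - W (m
    x)) + c' • (m x + fderiv ℝ m x x)) := by
  intro π a W c' hπ hW heq
  obtain ⟨hadm, hZ, hS, hN⟩ := hm
  by_cases hc' : 0 < c'
  · exact hL m π a W c' hadm hZ hπ hW hc' heq
  · have hbal := hEB m π a W c' hadm hπ hW heq
    have hP : 0 ≤ ∫ x, frobeniusNormSq (fderiv ℝ (curl m) x) :=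
      integral_nonneg fun x => frobeniusNormSq_nonneg _
    exact hc' (rate_pos_of_balance hc hν hZ hP hS hN hbal)

end MaximiserSetRigidity

end Summit.NavierStokesRegularity.NavierStokesRegularity.Theorems

end
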